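import Literature.NumberTheory.LFunctions.RepulsiveLogFreeDensitySingleModulus
import Literature.NumberTheory.LFunctions.ConreyIwaniec2020LacunaryCriticalZeros
import Literature.NumberTheory.LFunctions.ExceptionalCharacterTwinPrimes
import Literature.NumberTheory.LFunctions.RealZeroEffectiveRepulsionExplicit
import Literature.NumberTheory.LFunctions.RealZeroEffectiveRepulsionExplicitII
import Literature.Barriers.Parity.SiegelZeroDichotomyProofs
import Literature.NumberTheory.LFunctions.RealZeroLOneLowerBoundExplicit
import Literature.NumberTheory.LFunctions.SiegelZerosSmallZetaGaps
import HarnessLib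
import Summits.Parity.GeneralizedHardyLittlewood.Theorems.UnboundedSiegelZeros

/-!
# Dictionary between the «exceptional zero» predicates of the Siegel-instrument column and of the
# Landau–Siegel harvest (PROVED only; no definition, no named fact)

Topic `Literature/NumberTheory/LFunctions`. Typed for the cell `parity-realchar` (SIEGEL INSTRUMENT,
deliverable (3) «illusory-world conditionals»), whose list of record (`HOME/CONDITIONALS.md` §1) fixes
ONE family of hypothesis predicates — Tao–Teräväinen's `IsSiegelZero χ η` (quality `η`),
`UnboundedSiegelZeros`, Friedlander–Iwaniec's `SmallEtaCharacters ε` (`η(D) = L(1,χ_D) log D ≤ ε` at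
arbitrarily large `D`), `ExceptionalCharactersOfStrength A` — and requires a PROVED comparison lemma
for every further notion of «exceptional». Two such notions entered the tree on 2026-08-26 with the
literature harvest of the cell `landau-siegel`:

* `ThornerZaman2024PNTAP.ExceptionalPair χ₁ β₁` (Thorner–Zaman, Math. Z. 306 (2024), §1: `χ₁ ≠ 1`
  quadratic mod `q`, a real zero `β₁ ∈ [1 − 1/(50 log q), 1)` of `L(s,χ₁)` — McCurley's window), the
  hypothesis of the «illusory-world prime number theorem»
  `thornerZaman2024PNTAP_theorem1_exceptional` / `_corollary5_exceptional`
  (`RepulsiveLogFreeDensitySingleModulus.lean`);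
* `ConreyIwaniec2020.IsEpsExceptional κ D ε` (Conrey–Iwaniec, Acta Arith. 195 (2020), Def. 1.1:
  `L(1,κ) log|D| ≤ ε`), the vocabulary of `conreyIwaniec2020_theorem21`
  (`ConreyIwaniec2020LacunaryCriticalZeros.lean`).

This file PROVES the comparisons, so that the new sources fire on the column's predicates:

* `IsSiegelZero.exceptionalPair` — a Siegel zero of quality `η ≥ 50` (Tao–Teräväinen Def. 1.4:
  `β = 1 − 1/(η log q)`) IS an exceptional pair `(β, χ)` in Thorner–Zaman's sense;
  `ExceptionalPair.isSiegelZero` — conversely, for PRIMITIVE `χ₁`, an exceptional pair is a Siegel zero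
  of quality `1/((1 − β₁) log q) ≥ 50` (`ExceptionalPair.fifty_le_quality`);
  `UnboundedSiegelZeros.exceptionalPair_frequently` — under `UnboundedSiegelZeros` there are
  exceptional pairs (with primitive character, of any prescribed quality) to arbitrarily large moduli.
* `IsSiegelZero.thetaAP_asymptotic_of_corollary5` — READING of Thorner–Zaman's Corollary 5
  (exceptional case) on the column's predicate: modulo that named fact, for every Siegel zero of
  quality `η ≥ 50` attached to `χ mod q`, every reduced class `a` and every `x ≥ 3` with
  `λx/φ(q) ≥ x^{18/19}` (`λ = 1 − χ(a)x^{β−1}/β`, `β = 1 − 1/(η log q)`), the prime sum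
  `∑_{p ≤ x, p ≡ a (q)} log p` equals `λx/φ(q)` up to the printed (effective) relative error — the
  «annihilated / doubled classes» phenomenon (`χ(a) = ±1`) of topic I.2 in its sharpest typed form.
* `IsSiegelZero.thetaShortAP_asymptotic_of_theorem1` (appended) — the same for Theorem 1 (short
  intervals of progressions, `θ = 71/75`, exceptional case): topic I.3.
* `ConreyIwaniec2020.isEpsExceptional_natCast_iff` (`|D| = D` for a modulus `D : ℕ`),
  `smallEtaCharacters_iff_isEpsExceptional` — Friedlander–Iwaniec's `SmallEtaCharacters ε` is
  literally «`ε`-exceptional primitive quadratic characters (Conrey–Iwaniec) at arbitrarily large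
  conductor»; and `IsSiegelZero.isEpsExceptional` — a Siegel zero of quality `η` attached to a
  conductor `q ≥ 8` makes `χ` `ε`-exceptional with `ε = 55 (log q)²/η` (the tree's kernel bound
  `RealZeroRepulsion.isSiegelZero_eta_le`, explicit Montgomery–Vaughan (11.10)).

LABEL (cell rule): instrument / statement-layer glue, debt 0. WHAT THIS IS NOT: no claim that any
of these hypotheses holds; nothing here bears on the parity summit.

## References

* [ThornerZaman2024PNTAP] J. Thorner, A. Zaman, *Refinements to the prime number theorem for
  arithmetic progressions*, Math. Z. 306 (2024), §1 (the exceptional pair `(β₁, χ₁)`), Theorem 1,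
  Corollary 5, Remark 6.
* [ConreyIwaniec2020] J. B. Conrey, H. Iwaniec, *Critical zeros of lacunary `L`-functions*, Acta
  Arith. 195 (2020), Definition 1.1.
* [TaoTeravainen2021] T. Tao, J. Teräväinen, JLMS 106 (2022), Definition 1.4 (quality of a Siegel
  zero).
* [FriedlanderIwaniec2019TwinPrimes] J. B. Friedlander, H. Iwaniec, Banach Center Publ. 118 (2019),
  (1.6) (`η(D)`).
* [MontgomeryVaughan2007] H. L. Montgomery, R. C. Vaughan, *Multiplicative Number Theory I*,
  Theorem 11.4 (11.10).
-/

noncomputable section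

open Literature.Barriers.Parity

namespace Literature.NumberTheory.LFunctions

open ThornerZaman2024PNTAP ConreyIwaniec2020

/-! ### Siegel zeros of quality `≥ 50` ↔ Thorner–Zaman's exceptional pairs -/

/-- For `q ≥ 3`, `log q > 1 > 0`. [folklore] -/
private theorem log_pos_of_three_le {q : ℕ} (hq : 3 ≤ q) : 0 < Real.log q :=
  Real.log_pos (by exact_mod_cast (show 1 < q by omega))

/-- **A Siegel zero of quality `η ≥ 50` is an exceptional pair in Thorner–Zaman's sense**:
`β = 1 − 1/(η log q)` lies in McCurley's window `[1 − 1/(50 log q), 1)`, `χ` is quadratic and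
non-principal (it is primitive of conductor `q ≥ 3`, `IsSiegelZero.three_le`), and `L(β, χ) = 0`.
[cite: ThornerZaman2024PNTAP, §1 (paragraph before Theorem 1: the exceptional pair (β₁, χ₁))]
[cite: TaoTeravainen2021, Definition 1.4] -/
theorem _root_.Literature.Barriers.Parity.IsSiegelZero.exceptionalPair {q : ℕ} [NeZero q]
    {χ : DirichletCharacter ℂ q} {η : ℝ} (hS : IsSiegelZero χ η) (hη : 50 ≤ η) :
    ExceptionalPair χ (1 - 1 / (η * Real.log q)) := by
  have hq3 : 3 ≤ q := hS.three_le
  have hlog : 0 < Real.log q := log_pos_of_three_le hq3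
  have hηpos : 0 < η := by linarith
  have hne : χ ≠ 1 := by
    intro h1
    have hcond : χ.conductor = q := hS.1
    rw [h1, DirichletCharacter.conductor_one] at hcond
    omega
  obtain ⟨_, hquad, _, hzero⟩ := hS
  refine ⟨hne, hquad, ?_, ?_, ?_⟩
  · -- `1 − 1/(50 log q) ≤ 1 − 1/(η log q)` since `50 log q ≤ η log q`
    have hle : 50 * Real.log q ≤ η * Real.log q := mul_le_mul_of_nonneg_right hη hlog.le
    have h50 : 0 < 50 * Real.log q := by positivity
    have : 1 / (η * Real.log q) ≤ 1 / (50 * Real.log q) := one_div_le_one_div_of_le h50 hle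
    linarith
  · have : 0 < 1 / (η * Real.log q) := by positivity
    linarith
  · exact_mod_cast hzero

/-- **The quality of an exceptional pair is at least `50`**: `β₁ ≥ 1 − 1/(50 log q)` and `β₁ < 1` give
`1/((1 − β₁) log q) ≥ 50` (for `q ≥ 2`, so that `log q > 0`).
[cite: ThornerZaman2024PNTAP, §1 (the exceptional pair (β₁, χ₁))] [cite: TaoTeravainen2021, Definition 1.4] -/
theorem ThornerZaman2024PNTAP.ExceptionalPair.fifty_le_quality {q : ℕ} [NeZero q] (hq : 2 ≤ q)
    {χ : DirichletCharacter ℂ q} {β : ℝ} (hE : ExceptionalPair χ β) :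
    50 ≤ 1 / ((1 - β) * Real.log q) := by
  obtain ⟨_, _, hβlo, hβ1, _⟩ := hE
  have hlog : 0 < Real.log q := Real.log_pos (by exact_mod_cast (show 1 < q by omega))
  have h1β : 0 < 1 - β := by linarith
  have hpos : 0 < (1 - β) * Real.log q := mul_pos h1β hlog
  -- `(1 − β) log q ≤ (1/(50 log q)) log q = 1/50`
  have hle : (1 - β) * Real.log q ≤ 1 / (50 * Real.log q) * Real.log q :=
    mul_le_mul_of_nonneg_right (by linarith) hlog.le
  have hcancel : 1 / (50 * Real.log q) * Real.log q = 1 / 50 := by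
    field_simp
  rw [hcancel] at hle
  rw [le_div_iff₀ hpos]
  linarith

/-- **Conversely, an exceptional pair with PRIMITIVE character is a Siegel zero** (Tao–Teräväinen's
sense) of quality `η = 1/((1 − β₁) log q) ≥ 50 ≥ 10`: indeed `1 − 1/(η log q) = β₁`. (Thorner–Zaman
do not require primitivity; the column's predicate does.)
[cite: ThornerZaman2024PNTAP, §1 (the exceptional pair (β₁, χ₁))] [cite: TaoTeravainen2021, Definition 1.4] -/
theorem ThornerZaman2024PNTAP.ExceptionalPair.isSiegelZero {q : ℕ} [NeZero q] (hq : 2 ≤ q)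
    {χ : DirichletCharacter ℂ q} {β : ℝ} (hE : ExceptionalPair χ β) (hprim : χ.IsPrimitive) :
    IsSiegelZero χ (1 / ((1 - β) * Real.log q)) := by
  have h50 := hE.fifty_le_quality hq
  obtain ⟨_, hquad, _, hβ1, hzero⟩ := hE
  have hlog : 0 < Real.log q := Real.log_pos (by exact_mod_cast (show 1 < q by omega))
  have h1β : (1 - β) ≠ 0 := by intro h; linarith
  refine ⟨hprim, hquad, by linarith, ?_⟩
  have hβ : 1 - 1 / (1 / ((1 - β) * Real.log q) * Real.log q) = β := by
    field_simp
    ring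
  rw [hβ]
  exact hzero

/-- **Under `UnboundedSiegelZeros` exceptional pairs (with primitive character, of any prescribed
quality) occur to arbitrarily large moduli** — so every «exceptional case» theorem of Thorner–Zaman
is non-vacuously in force along a sequence of moduli in that world.
[cite: TaoTeravainen2021, Definition 1.4 and §1.1 (the hypothesis "Siegel zeros exist")]
[cite: ThornerZaman2024PNTAP, §1 (the exceptional pair (β₁, χ₁))] -/
theorem _root_.Literature.Barriers.Parity.UnboundedSiegelZeros.exceptionalPair_frequently
    (hU : Summit.Parity.GeneralizedHardyLittlewood.UnboundedSiegelZeros) (η₀ : ℝ) (q₀ : ℕ) :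
    ∃ (q : ℕ) (_ : NeZero q) (χ : DirichletCharacter ℂ q) (η : ℝ), q₀ ≤ q ∧ η₀ ≤ η ∧ 50 ≤ η ∧
      χ.IsPrimitive ∧ ExceptionalPair χ (1 - 1 / (η * Real.log q)) := by
  obtain ⟨q, hq, χ, η, hq₀, hη₀, hS⟩ := hU (max η₀ 50) q₀
  exact ⟨q, hq, χ, η, hq₀, le_trans (le_max_left _ _) hη₀, le_trans (le_max_right _ _) hη₀, hS.1,
    hS.exceptionalPair (le_trans (le_max_right _ _) hη₀)⟩

/-! ### Reading of Thorner–Zaman's Corollary 5 (exceptional case) on the column's predicate -/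

/-- **The illusory-world prime number theorem for progressions, on `IsSiegelZero`** (modulo the named
fact `thornerZaman2024PNTAP_corollary5_exceptional`): there are absolute effective `c > 0`, `K ≥ 0`
such that for every Siegel zero of quality `η ≥ 50` attached to `χ mod q` (`β = 1 − 1/(η log q)`),
every unit `a mod q` and every `x ≥ 3` with `λx/φ(q) ≥ x^{18/19}`, `λ = 1 − χ(a)x^{β−1}/β`:
`|∑_{p ≤ x, p ≡ a (q)} log p − λx/φ(q)| ≤ K (λx/φ(q)) (exp(−c log x/log q) + exp(−c (log x)^{3/5}(log log x)^{−1/5}))`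
— the classes with `χ(a) = 1` are depleted and those with `χ(a) = −1` doubled, with an effective
error, uniformly in the Linnik range. [cite: ThornerZaman2024PNTAP, Corollary 5 and Remark 6 p.4]
[cite: TaoTeravainen2021, Definition 1.4] -/
theorem _root_.Literature.Barriers.Parity.IsSiegelZero.thetaAP_asymptotic_of_corollary5
    (h5 : thornerZaman2024PNTAP_corollary5_exceptional) :
    ∃ c : ℝ, 0 < c ∧ ∃ K : ℝ, 0 ≤ K ∧
      ∀ (q : ℕ) [NeZero q] (χ : DirichletCharacter ℂ q) (η : ℝ), IsSiegelZero χ η → 50 ≤ η →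
        ∀ (a : ZMod q), IsUnit a → ∀ x : ℝ, 3 ≤ x →
          x ^ ((18 : ℝ) / 19) ≤
              (1 - (χ a).re * x ^ ((1 - 1 / (η * Real.log q)) - 1) / (1 - 1 / (η * Real.log q))) *
                x / Nat.totient q →
            |thetaShortAP q a x x -
                (1 - (χ a).re * x ^ ((1 - 1 / (η * Real.log q)) - 1) / (1 - 1 / (η * Real.log q))) *
                  x / Nat.totient q| ≤
              K * ((1 - (χ a).re * x ^ ((1 - 1 / (η * Real.log q)) - 1) /
                  (1 - 1 / (η * Real.log q))) * x / Nat.totient q) *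
                (Real.exp (-c * Real.log x / Real.log q) +
                  Real.exp (-c * Real.log x ^ ((3 : ℝ) / 5) /
                    Real.log (Real.log x) ^ ((1 : ℝ) / 5))) := by
  obtain ⟨c, hc, K, hK, h⟩ := h5
  refine ⟨c, hc, K, hK, fun q _ χ η hS hη a ha x hx hrange => ?_⟩
  exact h q (le_trans (by norm_num) hS.three_le) χ _ (hS.exceptionalPair hη) a ha x hx hrange

/-! ### Conrey–Iwaniec's `ε`-exceptional characters ↔ Friedlander–Iwaniec's `η(D) ≤ ε` -/

/-- For a modulus `D : ℕ` the discriminant-side absolute value is harmless: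
`IsEpsExceptional κ (D : ℤ) ε ↔ ‖L(1, κ)‖ log D ≤ ε`. [cite: ConreyIwaniec2020, Def. 1.1]
[cite: FriedlanderIwaniec2019TwinPrimes, (1.6)] -/
theorem ConreyIwaniec2020.isEpsExceptional_natCast_iff {D : ℕ} [NeZero D]
    (κ : DirichletCharacter ℂ D) (ε : ℝ) :
    IsEpsExceptional κ (D : ℤ) ε ↔ ‖κ.LFunction 1‖ * Real.log D ≤ ε := by
  unfold IsEpsExceptional
  rw [Int.cast_natCast, abs_of_nonneg (Nat.cast_nonneg D)]

/-- **`SmallEtaCharacters ε` is «`ε`-exceptional primitive quadratic characters at arbitrarily large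
conductor»** (Friedlander–Iwaniec's (1.6) in Conrey–Iwaniec's Definition 1.1 vocabulary).
[cite: ConreyIwaniec2020, Def. 1.1] [cite: FriedlanderIwaniec2019TwinPrimes, (1.6)] -/
theorem smallEtaCharacters_iff_isEpsExceptional (ε : ℝ) :
    SmallEtaCharacters ε ↔
      ∀ q₀ : ℕ, ∃ (D : ℕ) (_ : NeZero D) (χ : DirichletCharacter ℂ D),
        q₀ ≤ D ∧ 3 ≤ D ∧ χ.IsPrimitive ∧ χ.IsQuadratic ∧ IsEpsExceptional χ (D : ℤ) ε := by
  unfold SmallEtaCharacters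
  constructor
  · intro h q₀
    obtain ⟨D, hD, χ, h₀, h3, hprim, hquad, hη⟩ := h q₀
    exact ⟨D, hD, χ, h₀, h3, hprim, hquad, (isEpsExceptional_natCast_iff χ ε).mpr hη⟩
  · intro h q₀
    obtain ⟨D, hD, χ, h₀, h3, hprim, hquad, hη⟩ := h q₀
    exact ⟨D, hD, χ, h₀, h3, hprim, hquad, (isEpsExceptional_natCast_iff χ ε).mp hη⟩

/-- **A Siegel zero makes its character `ε`-exceptional with `ε = 55 (log q)²/η`** (Conrey–Iwaniec's
Def. 1.1), for conductors `q ≥ 8`: the tree's explicit Montgomery–Vaughan (11.10),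
`RealZeroRepulsion.isSiegelZero_eta_le`. So for quality `η ≥ 55 (log q)²/ε` the «lacunarity» input
of Conrey–Iwaniec 2020 (`L(1,χ) log|D| ≤ ε`) is available for this character.
[cite: ConreyIwaniec2020, Def. 1.1] [cite: MontgomeryVaughan2007, Theorem 11.4 (11.10)]
[cite: TaoTeravainen2021, Definition 1.4] -/
theorem _root_.Literature.Barriers.Parity.IsSiegelZero.isEpsExceptional {q : ℕ} [NeZero q]
    (hq : 8 ≤ q) {χ : DirichletCharacter ℂ q} {η : ℝ} (hS : IsSiegelZero χ η) :
    IsEpsExceptional χ (q : ℤ) (55 * Real.log q ^ 2 / η) :=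
  (isEpsExceptional_natCast_iff χ _).mpr (RealZeroRepulsion.isSiegelZero_eta_le hq hS)

/-- The same with a prescribed `ε > 0`: quality `η ≥ 55 (log q)²/ε` at a conductor `q ≥ 8` gives an
`ε`-exceptional character. [cite: ConreyIwaniec2020, Def. 1.1] [cite: MontgomeryVaughan2007, Theorem 11.4 (11.10)] -/
theorem _root_.Literature.Barriers.Parity.IsSiegelZero.isEpsExceptional_of_quality_ge {q : ℕ}
    [NeZero q] (hq : 8 ≤ q) {χ : DirichletCharacter ℂ q} {η ε : ℝ} (hε : 0 < ε)
    (hS : IsSiegelZero χ η) (hη : 55 * Real.log q ^ 2 / ε ≤ η) :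
    IsEpsExceptional χ (q : ℤ) ε := by
  have hη10 : 10 ≤ η := hS.ten_le
  have hηpos : 0 < η := by linarith
  have h := hS.isEpsExceptional hq
  refine h.mono ?_
  -- `55 (log q)²/η ≤ ε` iff `55 (log q)² ≤ ε η`, which is `hη` rearranged
  rw [div_le_iff₀ hηpos]
  have := (div_le_iff₀ hε).mp hη
  linarith

/-! ### Appended 2026-08-26: Theorem 1 (short intervals, exceptional case) on `IsSiegelZero` -/

/-- **The illusory-world prime number theorem in SHORT INTERVALS of progressions, on `IsSiegelZero`**
(READING of Thorner–Zaman's Theorem 1, exceptional case, modulo the named fact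
`thornerZaman2024PNTAP_theorem1_exceptional`; appended 2026-08-26): for `0 < ε < 1 − 71/75` there are
effective `c > 0`, `K ≥ 0` such that for every Siegel zero of quality `η ≥ 50` attached to `χ mod q`
(`β = 1 − 1/(η log q)`), every unit `a mod q` and all `4 ≤ h ≤ x` with `λh/φ(q) ≥ x^{71/75+ε}`,
`λ = λ(x,q,a,h) = (1/h)∫_{x−h}^x (1 − χ(a)t^{β−1}) dt` (`ThornerZaman2024PNTAP.lambdaExc`):
`|∑_{x−h < p ≤ x, p ≡ a (q)} log p − λh/φ(q)| ≤ K (λh/φ(q)) exp(−c log x/errDenom q x h)` — topic I.3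
(short intervals) in its sharpest typed form. [cite: ThornerZaman2024PNTAP, Theorem 1 p.3]
[cite: TaoTeravainen2021, Definition 1.4] -/
theorem _root_.Literature.Barriers.Parity.IsSiegelZero.thetaShortAP_asymptotic_of_theorem1
    (h1 : thornerZaman2024PNTAP_theorem1_exceptional) {ε : ℝ} (hε : 0 < ε) (hε' : ε < 1 - 71 / 75) :
    ∃ c : ℝ, 0 < c ∧ ∃ K : ℝ, 0 ≤ K ∧
      ∀ (q : ℕ) [NeZero q] (χ : DirichletCharacter ℂ q) (η : ℝ), IsSiegelZero χ η → 50 ≤ η →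
        ∀ (a : ZMod q), IsUnit a → ∀ (x h : ℝ), 4 ≤ h → h ≤ x →
          x ^ (71 / 75 + ε) ≤
              lambdaExc χ (1 - 1 / (η * Real.log q)) a x h * h / Nat.totient q →
            |thetaShortAP q a x h - lambdaExc χ (1 - 1 / (η * Real.log q)) a x h * h / Nat.totient q| ≤
              K * (lambdaExc χ (1 - 1 / (η * Real.log q)) a x h * h / Nat.totient q) *
                Real.exp (-c * Real.log x / errDenom q x h) := by
  obtain ⟨c, hc, K, hK, h⟩ := h1 ε hε hε'
  refine ⟨c, hc, K, hK, fun q _ χ η hS hη a ha x hh h4 hhx hrange => ?_⟩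
  exact h q (le_trans (by norm_num) hS.three_le) χ _ (hS.exceptionalPair hη) a ha x hh h4 hhx hrange


/-! ### Appended 2026-08-27 (rc-cond g7): the `ε`-exceptional reading with the v2 constant -/

/-- **A Siegel zero of quality `η ≥ 40` makes its character `ε`-exceptional with `ε = (log q)²/η`**
(Conrey–Iwaniec's Def. 1.1), for conductors `q ≥ 232` — v2 of `IsSiegelZero.isEpsExceptional`
(`55 (log q)²/η`, `q ≥ 8`), from the Pólya–Vinogradov-strength bound
`RealZeroRepulsion.isSiegelZero_eta_le_log_sq_div`. [cite: ConreyIwaniec2020, Def. 1.1]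
[cite: MontgomeryVaughan2007, Theorem 11.4 (11.10)] [cite: TaoTeravainen2021, Definition 1.4] -/
theorem _root_.Literature.Barriers.Parity.IsSiegelZero.isEpsExceptional_v2 {q : ℕ} [NeZero q]
    (hq : 232 ≤ q) {χ : DirichletCharacter ℂ q} {η : ℝ} (hS : IsSiegelZero χ η) (h40 : 40 ≤ η) :
    IsEpsExceptional χ (q : ℤ) (Real.log q ^ 2 / η) :=
  (isEpsExceptional_natCast_iff χ _).mpr (RealZeroRepulsion.isSiegelZero_eta_le_log_sq_div hq hS h40)

/-- The same with a prescribed `ε > 0`: quality `η ≥ max 40 ((log q)²/ε)` at a conductor `q ≥ 232`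
gives an `ε`-exceptional character. [cite: ConreyIwaniec2020, Def. 1.1] [cite: MontgomeryVaughan2007, Theorem 11.4 (11.10)] -/
theorem _root_.Literature.Barriers.Parity.IsSiegelZero.isEpsExceptional_of_quality_ge_v2 {q : ℕ}
    [NeZero q] (hq : 232 ≤ q) {χ : DirichletCharacter ℂ q} {η ε : ℝ} (hε : 0 < ε)
    (hS : IsSiegelZero χ η) (h40 : 40 ≤ η) (hη : Real.log q ^ 2 / ε ≤ η) :
    IsEpsExceptional χ (q : ℤ) ε := by
  have hηpos : 0 < η := by linarith
  refine (hS.isEpsExceptional_v2 hq h40).mono ?_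
  rw [div_le_iff₀ hηpos]
  have := (div_le_iff₀ hε).mp hη
  linarith


/-! ### Appended 2026-08-27 (rc-cond g9): the explicit converse — an `ε`-exceptional character
(`η_χ = L(1,χ) log q ≤ ε ≤ 0.032`, conductor `≥ 10⁴`) carries a Siegel zero of quality `≥ 0.32/ε`

With `IsSiegelZero.isEpsExceptional_v2` (quality `η` ⇒ `ε`-exceptional, `ε = (log q)²/η`) the §1
dictionary is now two-directional WITH NUMBERS: `ε`-exceptional ⇒ Siegel zero of quality `≥ 0.32/ε`
(`RealZeroLOneLowerBoundExplicit.lean`: the hyperbola method at the zero gives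
`L(1,χ) ≥ 0.32 (1 − β)` in the Hecke window, and the kernel Hecke lemma supplies the zero when
`L(1,χ) < 1/(8 log q)`). The tree's earlier `SmallEtaCharacters ⇒ UnboundedSiegelZeros` glue
(`SmallEtaCharactersSiegelZeroBranch.lean`) runs through the ∃-constants of (11.10); here the
quality is numerical. -/

/-- **`ε`-exceptional ⇒ Siegel zero of quality `≥ 0.32/ε` (kernel).** For a primitive quadratic `χ`
of conductor `D ≥ 10⁴` and `0 < ε ≤ 0.032`: `IsEpsExceptional χ D ε` (Conrey–Iwaniec Def. 1.1:
`L(1,χ) log D ≤ ε`) gives `IsSiegelZero χ η` for some `η ≥ 0.32/ε`.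
[cite: ConreyIwaniec2020, Def. 1.1] [cite: TaoTeravainen2021, Definition 1.4]
[cite: MontgomeryVaughan2007, Theorem 11.4 (11.10)] -/
theorem ConreyIwaniec2020.IsEpsExceptional.exists_isSiegelZero {D : ℕ} [NeZero D]
    (hD : 10 ^ 4 ≤ D) {χ : DirichletCharacter ℂ D} (hprim : χ.IsPrimitive) (hquad : χ.IsQuadratic)
    {ε : ℝ} (hε0 : 0 < ε) (hε : ε ≤ 0.032) (h : IsEpsExceptional χ (D : ℤ) ε) :
    ∃ η : ℝ, 0.32 / ε ≤ η ∧ IsSiegelZero χ η :=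
  RealZeroRepulsion.exists_isSiegelZero_of_lOne_mul_log_le χ hD hprim hquad hε0 hε
    ((isEpsExceptional_natCast_iff χ ε).mp h)

/-- **`SmallEtaCharacters ε` ⇒ `SiegelZerosOfQuality (0.32/ε)`, explicitly (kernel).** For
`0 < ε ≤ 0.032`: if `η(D) = L(1,χ_D) log D ≤ ε` at arbitrarily large conductors (Friedlander–Iwaniec
(1.6)), then Siegel zeros of Tao–Teräväinen quality `≥ 0.32/ε` exist at arbitrarily large conductors
(Bondarenko–Heap's «exceptional sequence of quality `E₀ = 0.32/ε`»).
[cite: FriedlanderIwaniec2019TwinPrimes, (1.6)] [cite: TaoTeravainen2021, Definition 1.4]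
[cite: MontgomeryVaughan2007, Theorem 11.4 (11.10)] -/
theorem SmallEtaCharacters.siegelZerosOfQuality_explicit {ε : ℝ} (hε0 : 0 < ε) (hε : ε ≤ 0.032)
    (h : SmallEtaCharacters ε) : SiegelZerosOfQuality (0.32 / ε) := by
  intro q₀
  obtain ⟨D, hD, χ, hq₀, -, hprim, hquad, hη⟩ := h (max q₀ (10 ^ 4))
  haveI := hD
  have hq : 10 ^ 4 ≤ D := le_trans (le_max_right _ _) hq₀
  obtain ⟨η, hηge, hS⟩ :=
    RealZeroRepulsion.exists_isSiegelZero_of_lOne_mul_log_le χ hq hprim hquad hε0 hε hη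
  exact ⟨D, hD, χ, η, le_trans (le_max_left _ _) hq₀, hηge, hS⟩

/-- **Quality bookkeeping in both directions (kernel):** a Siegel zero of quality `η ≥ 40` at
`q ≥ 232` is `ε`-exceptional with `ε = (log q)²/η` (`isEpsExceptional_v2`), and an `ε`-exceptional
primitive quadratic character of conductor `≥ 10⁴` with `ε ≤ 0.032` carries a Siegel zero of quality
`≥ 0.32/ε`; so quality `η ≥ (log q)²/0.032` returns, through `ε = (log q)²/η`, a zero of quality
`≥ 0.32 η/(log q)²` — the round trip loses exactly the factor `(log q)²/0.32` of the explicit (11.10)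
sandwich `0.32 (1−β) ≤ L(1,χ) ≤ (1−β)(log q)²`. [cite: ConreyIwaniec2020, Def. 1.1]
[cite: TaoTeravainen2021, Definition 1.4] [cite: MontgomeryVaughan2007, Theorem 11.4 (11.10)] -/
theorem _root_.Literature.Barriers.Parity.IsSiegelZero.exists_isSiegelZero_roundTrip {q : ℕ}
    [NeZero q] (hq : 10 ^ 4 ≤ q) {χ : DirichletCharacter ℂ q} {η : ℝ} (hS : IsSiegelZero χ η)
    (hη : Real.log q ^ 2 / 0.032 ≤ η) :
    ∃ η' : ℝ, 0.32 * η / Real.log q ^ 2 ≤ η' ∧ IsSiegelZero χ η' := by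
  have hq232 : 232 ≤ q := le_trans (by norm_num) hq
  have hq8 : (8 : ℝ) ≤ q := by exact_mod_cast (le_trans (by norm_num) hq : 8 ≤ q)
  -- `log q ≥ 2` (`e² < 7.39 ≤ 8 ≤ q`)
  have hL2 : 2 ≤ Real.log q := by
    rw [Real.le_log_iff_exp_le (by linarith)]
    have h1 : Real.exp 2 = Real.exp 1 ^ 2 := by rw [← Real.exp_nat_mul]; norm_num
    have h2 : Real.exp 1 ^ 2 ≤ 2.7182818286 ^ 2 :=
      pow_le_pow_left₀ (Real.exp_pos 1).le Real.exp_one_lt_d9.le 2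
    rw [h1]
    linarith [show (2.7182818286 : ℝ) ^ 2 ≤ 8 by norm_num]
  have hLsq : 4 ≤ Real.log q ^ 2 := by nlinarith
  have hL2pos : 0 < Real.log q ^ 2 := by positivity
  have h10 : 10 ≤ η := hS.ten_le
  have hη0 : 0 < η := by linarith
  have h40 : 40 ≤ η := by
    have : (4 : ℝ) / 0.032 ≤ Real.log q ^ 2 / 0.032 :=
      div_le_div_of_nonneg_right hLsq (by norm_num)
    linarith [show (40 : ℝ) ≤ 4 / 0.032 by norm_num]
  set ε : ℝ := Real.log q ^ 2 / η with hεdef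
  have hε0 : 0 < ε := by positivity
  have hε : ε ≤ 0.032 := by
    rw [hεdef, div_le_iff₀ hη0]
    have := (div_le_iff₀ (by norm_num : (0 : ℝ) < 0.032)).mp hη
    linarith
  have hexc := hS.isEpsExceptional_v2 hq232 h40
  obtain ⟨η', hge, hS'⟩ := hexc.exists_isSiegelZero hq hS.1 hS.2.1 hε0 hε
  refine ⟨η', le_trans (le_of_eq ?_) hge, hS'⟩
  rw [hεdef]
  field_simp

/-! ### Appended (rc-cond g9): strength ⇒ quality, explicitly — the inverse of
`IsSiegelZero.norm_LFunction_one_lt_of_quality_gt` (`SiegelZeroAnalyticRanksReading.lean`) -/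

/-- **Strength `A` ⇒ a Siegel zero of quality `≥ 0.32 (log q)^{A−1}` (kernel).** For a primitive
quadratic `χ` mod `q ≥ 10⁴` and an exponent `A` with `(log q)^{1−A} ≤ 0.032` (room enough; e.g.
`A ≥ 3` at every `q ≥ 10⁴`): `‖L(1,χ)‖ ≤ (log q)^{−A}` gives `IsSiegelZero χ η` for some
`η ≥ 0.32 (log q)^{A−1}` — by `RealZeroRepulsion.exists_isSiegelZero_of_lOne_mul_log_le` with
`ε = (log q)^{1−A}`. Together with the tree's `IsSiegelZero.norm_LFunction_one_lt_of_quality_gt`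
(quality `η > 55 (log q)^{A+1}` ⇒ strength `A`) the strength/quality dictionary of §1 is explicit in
both directions. [cite: TaoTeravainen2021, Definition 1.4] [cite: MontgomeryVaughan2007, Theorem 11.4 (11.10)] -/
theorem exists_isSiegelZero_of_norm_LFunction_one_le_rpow {q : ℕ} [NeZero q] (hq : 10 ^ 4 ≤ q)
    {χ : DirichletCharacter ℂ q} (hprim : χ.IsPrimitive) (hquad : χ.IsQuadratic) {A : ℝ}
    (hroom : Real.log q ^ (1 - A) ≤ 0.032) (h : ‖χ.LFunction 1‖ ≤ Real.log q ^ (-A)) :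
    ∃ η : ℝ, 0.32 * Real.log q ^ (A - 1) ≤ η ∧ IsSiegelZero χ η := by
  have hq1 : (1 : ℝ) < q := by exact_mod_cast (lt_of_lt_of_le (by norm_num) hq : 1 < q)
  have hL0 : 0 < Real.log q := Real.log_pos hq1
  set ε : ℝ := Real.log q ^ (1 - A) with hεdef
  have hε0 : 0 < ε := Real.rpow_pos_of_pos hL0 _
  have hsmall : ‖χ.LFunction 1‖ * Real.log q ≤ ε := by
    have h1 : ‖χ.LFunction 1‖ * Real.log q ≤ Real.log q ^ (-A) * Real.log q :=
      mul_le_mul_of_nonneg_right h hL0.le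
    have h2 : Real.log q ^ (-A) * Real.log q = ε := by
      rw [hεdef, show (1 : ℝ) - A = -A + 1 by ring, Real.rpow_add hL0, Real.rpow_one]
    linarith
  obtain ⟨η, hη, hS⟩ :=
    RealZeroRepulsion.exists_isSiegelZero_of_lOne_mul_log_le χ hq hprim hquad hε0 hroom hsmall
  refine ⟨η, le_trans (le_of_eq ?_) hη, hS⟩
  rw [hεdef, show A - 1 = -(1 - A) by ring, Real.rpow_neg hL0.le]
  field_simp

/-- **At every `q ≥ 10⁴`, strength `3` suffices**: `‖L(1,χ)‖ ≤ (log q)^{−3}` ⇒ a Siegel zero of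
quality `≥ 0.32 (log q)²` (`(log q)^{−2} ≤ 1/81 ≤ 0.032`). [cite: TaoTeravainen2021, Definition 1.4]
[cite: MontgomeryVaughan2007, Theorem 11.4 (11.10)] -/
theorem exists_isSiegelZero_of_norm_LFunction_one_le_inv_log_cube {q : ℕ} [NeZero q]
    (hq : 10 ^ 4 ≤ q) {χ : DirichletCharacter ℂ q} (hprim : χ.IsPrimitive) (hquad : χ.IsQuadratic)
    (h : ‖χ.LFunction 1‖ ≤ Real.log q ^ (-(3 : ℝ))) :
    ∃ η : ℝ, 0.32 * Real.log q ^ (2 : ℝ) ≤ η ∧ IsSiegelZero χ η := by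
  have hq' : (10 : ℝ) ^ 4 ≤ q := by exact_mod_cast hq
  have hq0 : (0 : ℝ) < q := by linarith
  -- `log q ≥ 9`
  have hL9 : 9 ≤ Real.log q := by
    rw [Real.le_log_iff_exp_le hq0]
    have h1 : Real.exp 9 = Real.exp 1 ^ 9 := by rw [← Real.exp_nat_mul]; norm_num
    have h9 : Real.exp 1 ^ 9 ≤ 2.7182818286 ^ 9 :=
      pow_le_pow_left₀ (Real.exp_pos 1).le Real.exp_one_lt_d9.le 9
    rw [h1]
    calc Real.exp 1 ^ 9 ≤ 2.7182818286 ^ 9 := h9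
      _ ≤ (10 : ℝ) ^ 4 := by norm_num
      _ ≤ q := hq'
  have hL0 : 0 < Real.log q := by linarith
  have hroom : Real.log q ^ (1 - (3 : ℝ)) ≤ 0.032 := by
    rw [show (1 : ℝ) - 3 = -2 by norm_num, Real.rpow_neg hL0.le,
      show (2 : ℝ) = ((2 : ℕ) : ℝ) by norm_num, Real.rpow_natCast]
    have h81 : (81 : ℝ) ≤ Real.log q ^ 2 := by nlinarith
    calc (Real.log q ^ 2)⁻¹ ≤ (81 : ℝ)⁻¹ := by
          rw [inv_le_inv₀ (by positivity) (by norm_num)]; exact h81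
      _ ≤ 0.032 := by norm_num
  have := exists_isSiegelZero_of_norm_LFunction_one_le_rpow hq hprim hquad hroom h
  simpa [show (3 : ℝ) - 1 = 2 by norm_num] using this

end Literature.NumberTheory.LFunctions

end
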